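import Literature.AlgebraicGeometry.HodgeTheory.FermatSurfaceLinesRepresent
import Literature.AlgebraicGeometry.HodgeTheory.FermatEigenspaceMultiplicityOne
import HarnessLib

/-!
# Aoki's Thm. 1-1 on the Fermat surface: claim(δ) for every paired character `δ` of `X²ₘ`

Family `hodge`, layer `Literature/AlgebraicGeometry/HodgeTheory`. PROOF FILE (theorems only; no
definition, no named fact). N. Aoki, J. Math. Soc. Japan 39 (1987), Thm. 1-1 p. 386 ("the linear space
`L` represents `δ`", hence claim(δ) for `δ = (a₀, -a₀, …, a_r, -a_r)`), in dimension `2` (`r = 1`), on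
the tree's real carriers: for a character `δ` of `X²ₘ` which is PAIRED (`FermatCharacter.IsPaired`: a
fixed-point-free involution `σ` of the four coordinates with `δ ∘ σ = -δ`) and zero-free, the eigenline
`V(δ) ⊆ H²(X²ₘ(ℂ); ℂ)` consists of algebraic classes (`FermatCharacter.Claim m 1 δ`):

* `FermatCharacter.claim_one_of_linePairing` — the pairing `(0 1)(2 3)`: `V(δ)` is at most a line
  (`Ran1980_fermatEigenspace_le_span_holds`), the class of the line `L(u₀, u₀)` is supported on a
  codimension-`1` closed subset and its `δ`-component is non-zero
  (`FermatSurface.fermatProjector_lineClass_ne_zero`), so "represents ⟹ claim"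
  (`FermatCharacter.claim_of_projector_fermatLinearSubspaceClass_ne_zero`);
* `FermatSurface.exists_perm_conj_linePairing` — every fixed-point-free involution of four letters is
  conjugate to `(0 1)(2 3)` (`decide`);
* `FermatCharacter.claim_one_of_isPaired` — **claim(δ) for every zero-free paired `δ`** (permutation
  invariance of claim, `FermatCharacter.claim_comp_perm_iff`).

In print this is "`NS(X²ₘ) ⊗ ℂ ⊇ V(δ)` for the decomposable `δ`, spanned by the classes of the `3m²`
lines" (Shioda, Math. Ann. 245 (1979) §1; Aoki–Shioda 1983 §2).

## References

* [Aoki1987] N. Aoki, Some new algebraic cycles on Fermat varieties, J. Math. Soc. Japan 39 (1987),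
  Thm. 1-1 p. 386.
* [Shioda1979HodgeFermat] T. Shioda, The Hodge conjecture for Fermat varieties, Math. Ann. 245 (1979), §1.
* [Ran1980] Z. Ran, Cycles on Fermat hypersurfaces, Compositio Math. 42 (1980), Prop. 1.7 (i), Prop. 1.14.
-/

noncomputable section

open CategoryTheory AlgebraicGeometry
open Literature.AlgebraicGeometry.Motives Literature.AlgebraicTopology.SingularHomology

namespace Literature.AlgebraicGeometry.HodgeTheory

variable {m : ℕ}

/-- **Every fixed-point-free involution of the four coordinates is conjugate to `(0 1)(2 3)`**:
there is a permutation `π` with `π ∘ σ₀ = σ ∘ π` (a finite check). [folklore] -/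
theorem FermatSurface.exists_perm_conj_linePairing :
    ∀ σ : Equiv.Perm (Fin (2 * 1 + 2)), (∀ i, σ i ≠ i) → (∀ i, σ (σ i) = i) →
      ∃ π : Equiv.Perm (Fin (2 * 1 + 2)), ∀ i, π (FermatSurface.linePairing i) = σ (π i) := by
  decide

/-- **Aoki's Thm. 1-1 on the Fermat surface for the pairing `(0 1)(2 3)`**: for a character
`δ = (δ₀, δ₁, δ₂, δ₃)` of `X²ₘ` with `δ₀, δ₂ ≠ 0` and `δ₀ + δ₁ = 0 = δ₂ + δ₃`, claim(δ) holds — `V(δ)` is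
at most a line (Ran Prop. 1.7 (i), `Ran1980_fermatEigenspace_le_span_holds`) and the class of the line
`L(u₀, u₀) : x₀ = u₀ x₁, x₂ = u₀ x₃` (`u₀ᵐ = -1`), supported in codimension `1`, has non-zero
`δ`-component (`FermatSurface.fermatProjector_lineClass_ne_zero`), so "represents ⟹ claim" applies
(`FermatCharacter.claim_of_projector_fermatLinearSubspaceClass_ne_zero`).
[cite: Aoki1987, Thm. 1-1 p. 386] [cite: Ran1980, Prop. 1.7 (i) and Prop. 1.14] -/
theorem FermatCharacter.claim_one_of_linePairing [NeZero m] {δ : Fin (2 * 1 + 2) → ZMod m}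
    (h0 : δ 0 ≠ 0) (h2 : δ 2 ≠ 0) (h01 : δ 0 + δ 1 = 0) (h23 : δ 2 + δ 3 = 0) :
    FermatCharacter.Claim m 1 δ := by
  obtain ⟨u₀, hu₀⟩ := IsAlgClosed.exists_pow_nat_eq (-1 : ℂ) (NeZero.pos m)
  have h1 : δ 1 = -δ 0 := by rw [← sub_eq_zero, sub_neg_eq_add, add_comm, h01]
  have h3 : δ 3 = -δ 2 := by rw [← sub_eq_zero, sub_neg_eq_add, add_comm, h23]
  have hadm : FermatCharacter.IsAdmissible δ := by
    refine ⟨FermatSurface.forall_fin_four h0 (by rw [h1]; exact neg_ne_zero.mpr h0) h2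
      (by rw [h3]; exact neg_ne_zero.mpr h2), ?_⟩
    rw [Fin.sum_univ_four, h1, h3]
    ring
  have hdim := Ran1980_fermatEigenspace_le_span_holds m 1 δ one_pos hadm
  refine FermatCharacter.claim_of_projector_fermatLinearSubspaceClass_ne_zero le_rfl hdim
    complexOrientationFamily FermatSurface.linePairing_ne FermatSurface.linePairing_linePairing
    (FermatSurface.lineEps (FermatSurface.pair u₀ u₀))
    (FermatSurface.lineEps_pow (FermatSurface.pair_pow hu₀ hu₀)) ?_
  rw [← FermatSurface.lineClass_eq_fermatLinearSubspaceClass]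
  exact FermatSurface.fermatProjector_lineClass_ne_zero δ h0 h2 h01 h23 hu₀ hu₀

/-- **Aoki's Thm. 1-1 on the Fermat surface: claim(δ) for every zero-free paired character `δ` of
`X²ₘ`** (`δ ∘ σ = -δ` for a fixed-point-free involution `σ` of the coordinates): conjugate `σ` to
`(0 1)(2 3)` by a permutation `π` (`FermatSurface.exists_perm_conj_linePairing`), apply
`FermatCharacter.claim_one_of_linePairing` to `δ ∘ π`, and use the invariance of claim under
permutations of the coordinates (`FermatCharacter.claim_comp_perm_iff`). Equivalently: the eigenlines
`V(δ)` of the decomposable characters lie in the span of the classes of the `3m²` lines.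
[cite: Aoki1987, Thm. 1-1 p. 386] [cite: Shioda1979HodgeFermat, §1] -/
theorem FermatCharacter.claim_one_of_isPaired [NeZero m] {δ : Fin (2 * 1 + 2) → ZMod m}
    (hδ : FermatCharacter.IsPaired δ) (hδ0 : ∀ i, δ i ≠ 0) : FermatCharacter.Claim m 1 δ := by
  obtain ⟨σ, hσ1, hσ2, hσδ⟩ := hδ
  obtain ⟨π, hπ⟩ := FermatSurface.exists_perm_conj_linePairing σ hσ1 hσ2
  have key : FermatCharacter.Claim m 1 (δ ∘ π) := by
    refine FermatCharacter.claim_one_of_linePairing (hδ0 _) (hδ0 _) ?_ ?_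
    · change δ (π 0) + δ (π 1) = 0
      rw [← FermatSurface.linePairing_zero, hπ, hσδ, add_neg_cancel]
    · change δ (π 2) + δ (π 3) = 0
      rw [← FermatSurface.linePairing_two, hπ, hσδ, add_neg_cancel]
  exact (FermatCharacter.claim_comp_perm_iff δ π).mp key

end Literature.AlgebraicGeometry.HodgeTheory

end
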